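import Summits.AnomalousDissipation.AnomalousDissipation.Theorems.SawtoothPulseCascadeK1LocalisedCascadeRestColumns

/-!
# K1loc, line `Spectral` — S-D (first good piece): THE SLAB OF LOW HORIZONTAL FREQUENCIES

Helper file of the prover lane on the crux `K1LocalisedCascade` (stmt-AnomalousDissipation-19491), route
`SawtoothPulseCascade`, registered line `Cruxes.K1LocalisedCascade.Spectral` (one open stub `stub_highModeConcentration`).
The ledger's start symbol at phase `i₀` contains the whole SLAB `{|k₀| < cρ^{i₀}}` (hypothesis `hlow` of
`…LedgerSharp.highModeConcentration_of_ledger_threshold`), i.e. infinitely many modes off the column; `…RestColumns` bounded finite rest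
sets.  Here the rest set is the slab minus the column, `{0 < |k₀| ≤ K}` (all `k₁`): each horizontal frequency `m` is a full column of
the modulated iterate `e_{−m e₀} a_n` (`hasSum_column_shift`), so
`Σ'_{0<|k₀|≤K} |𝓕(a_n)(k)|² ≤ 2K(C_K² + (2C_K+1)vol(Bad))` (`slabEnergy_le_lt`), and the first-good-piece lemma holds for every symbol
`|μ| ≤ 1` supported in the slab `{|k₀| ≤ K}`, `K < (γ²−3)^n` (`sqrt_lowModes_le_firstGoodPiece_slab`, `Λ = 2K(C_K² + (2C_K+1)V_B)`).

[cite: ElgindiLissMattingly2025, §1.2.2, §3.1] [cite: Grafakos2014, Prop. 3.2.7 (3)] [cite: DEIJ2022, (1.2)–(1.3)] [problem: turb]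
-/

-- `Summit.<Summit>.<Problem>`: single-conjunct summit, the duplicate namespace segment is deliberate.
set_option linter.dupNamespace false

noncomputable section

namespace Summit.AnomalousDissipation.AnomalousDissipation.Theorems.SawtoothPulseCascade.K1Start

open Set Function MeasureTheory UnitAddTorus
open scoped ENNReal
open Literature.Analysis Literature.Analysis.FunctionSpaces Literature.Analysis.FunctionSpaces.Torus
open Literature.Analysis.FluidPDE.ShearStage
open Literature.Analysis.FluidPDE.SawtoothCascade Literature.Analysis.FluidPDE.SawtoothCascade.CascadeParams

/-! ## §1 A horizontal frequency is the column of the modulated function -/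

/-- **Parseval on one horizontal frequency**: for continuous `f : 𝕋² → ℂ` and `m : ℤ`, with `v = e_{−m e₀} f` and `axisAvg 0 v` continuous,
`Σ_{k : k₀ = m} |𝓕f(k)|²` sums to `∫ ‖axisAvg 0 v‖²`. [cite: Grafakos2014, Prop. 3.2.7 (3)] -/
theorem hasSum_column_shift {f : UnitAddTorus (Fin 2) → ℂ} (hf : Continuous f) (m : ℤ)
    (hA : Continuous (axisAvg 0 (fun x => mFourier (-(Pi.single 0 m : Fin 2 → ℤ)) x * f x))) :
    HasSum (fun k : Fin 2 → ℤ => (if k 0 = m then (1 : ℝ) else 0) * ‖mFourierCoeff f k‖ ^ 2)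
      (∫ x, ‖axisAvg 0 (fun x => mFourier (-(Pi.single 0 m : Fin 2 → ℤ)) x * f x) x‖ ^ 2) := by
  set c : Fin 2 → ℤ := Pi.single 0 m with hc
  have hvc : Continuous (fun x => mFourier (-c) x * f x) := (mFourier (-c)).continuous.mul hf
  have hP := (Equiv.subRight c).hasSum_iff.mpr (hasSum_axisBlock hvc 0 hA)
  refine hP.congr_fun fun k => ?_
  show (if k 0 = m then (1 : ℝ) else 0) * ‖mFourierCoeff f k‖ ^ 2 =
    (if (k - c) 0 = 0 then (1 : ℝ) else 0) * ‖mFourierCoeff (fun x => mFourier (-c) x * f x) (k - c)‖ ^ 2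
  rw [mFourierCoeff_char_mul, sub_add_cancel]
  have h1 : ((k - c) 0 = 0) ↔ (k 0 = m) := by rw [Pi.sub_apply, hc, Pi.single_eq_same, sub_eq_zero]
  simp only [h1]

/-! ## §2 The slab energy of the inviscid iterate -/

section Cascade

variable (P : CascadeParams)

/-- **The slab energy through modulated columns.**  For `K < (γ²−3)^n`:
`Σ'_{k : 0 < |k₀| ≤ K} |𝓕(a_n)(k)|² ≤ 2K · (C_K² + (2C_K + 1)·vol(Bad))`, `C_K = B_n/(π(1 − K(γ²−3)^{−n})) + 2πE_V`.
[cite: ElgindiLissMattingly2025, §1.2.2, §3.1] [cite: Grafakos2014, Prop. 3.2.7 (3)] -/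
theorem slabEnergy_le_lt (hγ : 1 ≤ P.γ) (h8 : 8 ≤ P.γ ^ 2) (hδ₀ : 0 < P.δ₀) (hd : 0 < P.d) (hN₀ : 1 ≤ P.N₀) (hρ : 1 ≤ P.ρN)
    {M₁ M₂ : ℝ} (hM₁ : 0 < M₁) (hM : 1 ≤ M₂) (hMδ : ∀ j, M₂ * P.δ j < Real.pi / 2) {n : ℕ}
    (a b : ℕ → UnitAddTorus (Fin 2) → ℝ) (has : ∀ j, IsSmooth (a j)) (h0 : a 0 = datum)
    (hb : ∀ j, b j = a j ∘ shearMap 0 1 (amp ⟨P.U j, P.U_periodic j, P.contDiff_U (P.δ_pos hδ₀ hd j)⟩ P.γ))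
    (hab : ∀ j, a (j + 1) = b j ∘ shearMap 1 0 (amp ⟨P.U j, P.U_periodic j, P.contDiff_U (P.δ_pos hδ₀ hd j)⟩ P.γ))
    {EV EH : ℝ} (B : ℕ → ℝ) (hEV0 : 0 ≤ EV)
    (hEV : ∀ ℓ, ℓ ≤ n → (∑ i ∈ Finset.range ℓ, (1 + P.γ + P.γ ^ 2) ^ i *
        ((P.γ ^ 2 * (1 / (2 * P.N (n - ℓ + i)) - M₂ * P.δ (n - ℓ + i) / (Real.pi * P.N (n - ℓ + i))) +
          P.γ * (1 / (2 * P.N (n - ℓ + i)) - M₂ * P.δ (n - ℓ + i) / (Real.pi * P.N (n - ℓ + i)))) *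
          (2 * Real.exp (-(M₂ ^ 2 / 2))))) ≤ EV)
    (hEH : (1 + P.γ) * EV + P.γ * (2 * Real.exp (-(M₂ ^ 2 / 2))) * ((1 + P.γ + P.γ ^ 2) ^ n + EV) ≤ EH)
    (hζV : ∀ j, j < n → M₂ * P.δ j / (2 * Real.pi * P.N j) + EV ≤ M₁ * P.δ j / (2 * Real.pi * P.N j))
    (hζH : ∀ j, j < n → M₂ * P.δ j / (2 * Real.pi * P.N j) + EH ≤ M₁ * P.δ j / (2 * Real.pi * P.N j))
    (hB0 : ((P.γ ^ 2 - 3) ^ n)⁻¹ ≤ B 0)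
    (hB : ∀ ℓ, ℓ < n → 4 * B ℓ + 2 * P.N (n - ℓ - 1) * (P.γ + 2 + 2 / P.γ) / (P.γ ^ 2 - 3) ^ (n - ℓ) ≤ B (ℓ + 1))
    (Bad : Set (UnitAddTorus (Fin 2))) (hBadm : MeasurableSet Bad)
    (hBad : ∀ (Y : EuclideanSpace ℝ (Fin 2)) (z : ℝ → ℕ → EuclideanSpace ℝ (Fin 2)),
      (∀ s, z s n = Y + s • EuclideanSpace.single 0 1) →
      (∀ s, ∀ j < n, z s j = shearMapLift 0 1 (amp ⟨P.U j, P.U_periodic j, P.contDiff_U (P.δ_pos hδ₀ hd j)⟩ P.γ)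
        (shearMapLift 1 0 (amp ⟨P.U j, P.U_periodic j, P.contDiff_U (P.δ_pos hδ₀ hd j)⟩ P.γ) (z s (j + 1)))) →
      ∀ s : ℝ, (∃ j', j' < n ∧ ∃ q : ℤ,
        |(z s (j' + 1)) 0 - ((q : ℝ) / 2 + 1 / 4) / P.N j'| < M₁ * P.δ j' / (2 * Real.pi * P.N j') + EV ∨
        |((z s (j' + 1)) 1 - P.γ * P.U j' ((z s (j' + 1)) 0)) - ((q : ℝ) / 2 + 1 / 4) / P.N j'| <
          M₁ * P.δ j' / (2 * Real.pi * P.N j') + EH) →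
        proj (Y + s • EuclideanSpace.single 0 1) ∈ Bad)
    {K : ℕ} (hK : (K : ℝ) < (P.γ ^ 2 - 3) ^ n) :
    ∑' k : Fin 2 → ℤ, (if (k 0 ≠ 0 ∧ |k 0| ≤ (K : ℤ)) then (1 : ℝ) else 0) * ‖mFourierCoeff (fun x => (a n x : ℂ)) k‖ ^ 2 ≤
      2 * K * ((B n / (Real.pi * (1 - K / (P.γ ^ 2 - 3) ^ n)) + 2 * Real.pi * EV) ^ 2 +
        (2 * (B n / (Real.pi * (1 - K / (P.γ ^ 2 - 3) ^ n)) + 2 * Real.pi * EV) + 1) * (volume Bad).toReal) := by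
  classical
  have hπ := Real.pi_pos
  have hγ0 : 0 < P.γ := by linarith
  have hg3 : 0 < P.γ ^ 2 - 3 := by nlinarith
  have hBn : 0 < B n := B_pos P hγ h8 B hB0 hB n le_rfl
  obtain ⟨hh_meas, hh01, hh_int⟩ := axisAvg_indicator_props hBadm
  set h : UnitAddTorus (Fin 2) → ℝ := axisAvg 0 (Bad.indicator fun _ => (1 : ℝ)) with hh
  have hθ : 0 < 1 - (K : ℝ) / (P.γ ^ 2 - 3) ^ n := by
    rw [sub_pos, div_lt_one (pow_pos hg3 n)]; exact hK
  set CK : ℝ := B n / (Real.pi * (1 - K / (P.γ ^ 2 - 3) ^ n)) + 2 * Real.pi * EV with hCK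
  have hCK0 : 0 ≤ CK := by positivity
  obtain ⟨hg_i, hΓ⟩ := integral_const_add_sq_le hh_meas hh01 hCK0
  rw [hh_int] at hΓ
  have hfc : Continuous fun x => (a n x : ℂ) := Complex.continuous_ofReal.comp (has n).continuous
  -- one horizontal frequency: `HasSum` onto the column energy of the modulated iterate, which is `≤ CK² + (2CK+1)vol`
  have hcol : ∀ m : ℤ, |m| ≤ (K : ℤ) → ∃ I : ℝ, I ≤ CK ^ 2 + (2 * CK + 1) * (volume Bad).toReal ∧
      HasSum (fun k : Fin 2 → ℤ => (if k 0 = m then (1 : ℝ) else 0) * ‖mFourierCoeff (fun x => (a n x : ℂ)) k‖ ^ 2) I := by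
    intro m hmK
    set c : Fin 2 → ℤ := Pi.single 0 m with hc
    set v : UnitAddTorus (Fin 2) → ℂ := fun x => mFourier (-c) x * (a n x : ℂ) with hv
    have hvs : IsSmooth v := ContDiff.mul (isSmooth_mFourier (-c)) (Complex.ofRealCLM.contDiff.comp (has n))
    have hAc : Continuous (axisAvg 0 v) := (hvs.axisAvg 0).continuous
    have hc0 : ((c 0 : ℤ) : ℝ) = m := by rw [hc, Pi.single_eq_same]
    have hmR : |((c 0 : ℤ) : ℝ)| < (P.γ ^ 2 - 3) ^ n := by
      rw [hc0]; exact lt_of_le_of_lt (by exact_mod_cast hmK) hK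
    have hpt : ∀ x, ‖axisAvg 0 v x‖ ≤ CK + h x := by
      intro x
      obtain ⟨Y, rfl⟩ := proj_surjective x
      obtain ⟨z, hzn, hz⟩ := exists_traj P hδ₀ hd n Y
      have hnorm : ∀ y : UnitAddTorus (Fin 2), ‖mFourier (-c) y‖ = 1 := fun y => by
        simp only [mFourier, ContinuousMap.coe_mk, norm_prod]
        exact Finset.prod_eq_one fun i _ => by simp
      rw [hv, axisAvg_char_mul_eq P hδ₀ hd a b h0 hb hab n c Y z hzn hz, norm_mul, hnorm, one_mul]
      refine (chord_sum_le_axisAvg_lt P hγ h8 hδ₀ hd hN₀ hρ hM₁ hM hMδ B hEV0 hEV hEH hζV hζH hB0 hB Bad hBadm hBad Y z hzn hz hmR).trans ?_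
      have h2 : B n / (Real.pi * (1 - |((c 0 : ℤ) : ℝ)| / (P.γ ^ 2 - 3) ^ n)) ≤
          B n / (Real.pi * (1 - K / (P.γ ^ 2 - 3) ^ n)) := by
        refine div_le_div_of_nonneg_left hBn.le (by positivity) (mul_le_mul_of_nonneg_left ?_ hπ.le)
        have h3 : |((c 0 : ℤ) : ℝ)| ≤ K := by rw [hc0]; exact_mod_cast hmK
        have := div_le_div_of_nonneg_right h3 (pow_pos hg3 n).le
        linarith
      rw [hCK]
      linarith
    have hcolv : ∫ x, ‖axisAvg 0 v x‖ ^ 2 ≤ CK ^ 2 + (2 * CK + 1) * (volume Bad).toReal := by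
      refine le_trans (integral_mono ?_ hg_i fun x => ?_) hΓ
      · exact ((hAc.norm.pow 2).integrable_of_hasCompactSupport (HasCompactSupport.of_compactSpace _))
      · exact pow_le_pow_left₀ (norm_nonneg _) (hpt x) 2
    exact ⟨_, hcolv, hasSum_column_shift hfc m hAc⟩
  choose! I hI hsumI using hcol
  -- the slab indicator is the sum of the column indicators over `M = [-K, K] \ {0}`
  set M : Finset ℤ := (Finset.Icc (-(K : ℤ)) K).erase 0 with hM
  have hind : ∀ k : Fin 2 → ℤ, (if (k 0 ≠ 0 ∧ |k 0| ≤ (K : ℤ)) then (1 : ℝ) else 0) * ‖mFourierCoeff (fun x => (a n x : ℂ)) k‖ ^ 2 =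
      ∑ m ∈ M, (if k 0 = m then (1 : ℝ) else 0) * ‖mFourierCoeff (fun x => (a n x : ℂ)) k‖ ^ 2 := by
    intro k
    rw [← Finset.sum_mul, Finset.sum_ite_eq]
    have hiff : k 0 ∈ M ↔ (k 0 ≠ 0 ∧ |k 0| ≤ (K : ℤ)) := by
      rw [hM, Finset.mem_erase, Finset.mem_Icc, abs_le]
    simp only [hiff]
  have hS : HasSum (fun k : Fin 2 → ℤ => (if (k 0 ≠ 0 ∧ |k 0| ≤ (K : ℤ)) then (1 : ℝ) else 0) *
      ‖mFourierCoeff (fun x => (a n x : ℂ)) k‖ ^ 2) (∑ m ∈ M, I m) := by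
    simp_rw [hind]
    exact hasSum_sum fun m hm => hsumI m (abs_le.mpr (Finset.mem_Icc.mp (Finset.mem_erase.mp hm).2))
  rw [hS.tsum_eq]
  have hcardM : (M.card : ℝ) = 2 * K := by
    rw [hM, Finset.card_erase_of_mem (by simp), Int.card_Icc]
    have e : ((K : ℤ) + 1 - -(K : ℤ)).toNat = 2 * K + 1 := by omega
    rw [e]; push_cast; ring
  calc ∑ m ∈ M, I m ≤ ∑ m ∈ M, (CK ^ 2 + (2 * CK + 1) * (volume Bad).toReal) :=
        Finset.sum_le_sum fun m hm => hI m (abs_le.mpr (Finset.mem_Icc.mp (Finset.mem_erase.mp hm).2))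
    _ = 2 * K * (CK ^ 2 + (2 * CK + 1) * (volume Bad).toReal) := by rw [Finset.sum_const, nsmul_eq_mul, hcardM]

/-- **The analytic first good piece with symbolic smallness — slab form** (the one the ledger consumes: its start symbol contains the
slab `{|k₀| < cρ^{i₀}}`).  For every symbol `|μ| ≤ 1` vanishing at the modes with `|k₀| > K` (`K < (γ²−3)^n`), under the R1 inequalities:
`√(Σ' μ(k)²|𝓕(w(tStart n))(k)|²) ≤ √(Γ + Λ) + (viscous term)`, `Γ = C₀² + (2C₀+1)V_B`, `Λ = 2K(C_K² + (2C_K+1)V_B)`,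
`C₀ = B_n/π + 2πE_V`, `C_K = B_n/(π(1 − K(γ²−3)^{−n})) + 2πE_V`, `V_B = Σ_{j<n} 4M₃δ_j/π`.
[cite: ElgindiLissMattingly2025, §1.2.2, §3.1] [cite: DEIJ2022, (1.2)–(1.3)] -/
theorem sqrt_lowModes_le_firstGoodPiece_slab (hγ : 1 ≤ P.γ) (h8 : 8 ≤ P.γ ^ 2) (hδ₀ : 0 < P.δ₀) (hd : 0 < P.d) (hN₀ : 1 ≤ P.N₀) (hρ : 1 ≤ P.ρN)
    {M₁ M₂ : ℝ} (hM₁ : 0 < M₁) (hM : 1 ≤ M₂) (hMδ : ∀ j, M₂ * P.δ j < Real.pi / 2) {n : ℕ}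
    (a b : ℕ → UnitAddTorus (Fin 2) → ℝ) (has : ∀ j, IsSmooth (a j)) (h0 : a 0 = datum)
    (hb : ∀ j, b j = a j ∘ shearMap 0 1 (amp ⟨P.U j, P.U_periodic j, P.contDiff_U (P.δ_pos hδ₀ hd j)⟩ P.γ))
    (hab : ∀ j, a (j + 1) = b j ∘ shearMap 1 0 (amp ⟨P.U j, P.U_periodic j, P.contDiff_U (P.δ_pos hδ₀ hd j)⟩ P.γ))
    {EV EH : ℝ} (B : ℕ → ℝ) (hEV0 : 0 ≤ EV)
    (hEV : ∀ ℓ, ℓ ≤ n → (∑ i ∈ Finset.range ℓ, (1 + P.γ + P.γ ^ 2) ^ i *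
        ((P.γ ^ 2 * (1 / (2 * P.N (n - ℓ + i)) - M₂ * P.δ (n - ℓ + i) / (Real.pi * P.N (n - ℓ + i))) +
          P.γ * (1 / (2 * P.N (n - ℓ + i)) - M₂ * P.δ (n - ℓ + i) / (Real.pi * P.N (n - ℓ + i)))) *
          (2 * Real.exp (-(M₂ ^ 2 / 2))))) ≤ EV)
    (hEH : (1 + P.γ) * EV + P.γ * (2 * Real.exp (-(M₂ ^ 2 / 2))) * ((1 + P.γ + P.γ ^ 2) ^ n + EV) ≤ EH)
    (hζV : ∀ j, j < n → M₂ * P.δ j / (2 * Real.pi * P.N j) + EV ≤ M₁ * P.δ j / (2 * Real.pi * P.N j))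
    (hζH : ∀ j, j < n → M₂ * P.δ j / (2 * Real.pi * P.N j) + EH ≤ M₁ * P.δ j / (2 * Real.pi * P.N j))
    (hB0 : ((P.γ ^ 2 - 3) ^ n)⁻¹ ≤ B 0)
    (hB : ∀ ℓ, ℓ < n → 4 * B ℓ + 2 * P.N (n - ℓ - 1) * (P.γ + 2 + 2 / P.γ) / (P.γ ^ 2 - 3) ^ (n - ℓ) ≤ B (ℓ + 1))
    {M₃ : ℝ} (hM₃ : 1 ≤ M₃) (hM₃δ : ∀ j, M₃ * P.δ j < Real.pi / 2)
    (hV3 : ∀ j, j < n → M₁ * P.δ j / (2 * Real.pi * P.N j) + EV ≤ M₃ * P.δ j / (2 * Real.pi * P.N j))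
    (hH3 : ∀ j, j < n → M₁ * P.δ j / (2 * Real.pi * P.N j) + EH ≤ M₃ * P.δ j / (2 * Real.pi * P.N j))
    (μ : (Fin 2 → ℤ) → ℝ) (hμ1 : ∀ k, |μ k| ≤ 1) {K : ℕ} (hK : (K : ℝ) < (P.γ ^ 2 - 3) ^ n)
    (hμ : ∀ k, (K : ℤ) < |k 0| → μ k = 0) {κ₁ : ℝ} :
    ∀ κ ∈ Ioc (0 : ℝ) κ₁, ∀ w : ℝ → UnitAddTorus (Fin 2) → ℝ,
      FluidPDE.Torus.IsClassicalScalarTransportOn (Ico 0 1) κ P.field w → w 0 = datum →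
        Real.sqrt (∑' k, μ k ^ 2 * ‖mFourierCoeff (fun x => (w (tStart n) x : ℂ)) k‖ ^ 2) ≤
          Real.sqrt (((B n / Real.pi + 2 * Real.pi * EV) ^ 2 +
              (2 * (B n / Real.pi + 2 * Real.pi * EV) + 1) * ∑ j ∈ Finset.range n, 4 * M₃ * P.δ j / Real.pi) +
            2 * K * ((B n / (Real.pi * (1 - K / (P.γ ^ 2 - 3) ^ n)) + 2 * Real.pi * EV) ^ 2 +
              (2 * (B n / (Real.pi * (1 - K / (P.γ ^ 2 - 3) ^ n)) + 2 * Real.pi * EV) + 1) *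
                ∑ j ∈ Finset.range n, 4 * M₃ * P.δ j / Real.pi)) +
          Real.sqrt (2 * Real.pi * Real.sqrt (1 + (1 + P.γ) ^ 2) * (1 + P.γ) ^ (2 * n) *
            Real.sqrt (2 * κ₁ * tStart n * FluidPDE.Torus.scalarL2Sq datum)) := by
  classical
  have hπ := Real.pi_pos
  have hγ0 : 0 < P.γ := by linarith
  have hg3 : 0 < P.γ ^ 2 - 3 := by nlinarith
  have hBn : 0 < B n := B_pos P hγ h8 B hB0 hB n le_rfl
  obtain ⟨Bad, hBadm, hBadvol, hBad⟩ := exists_badSet_lt P hδ₀ hd hN₀ hρ (EV := EV) (EH := EH) hM₃ hM₃δ hV3 hH3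
  set VB : ℝ := ∑ j ∈ Finset.range n, 4 * M₃ * P.δ j / Real.pi with hVB
  have hVBge : (volume Bad).toReal ≤ VB := by
    have hterm : ∀ j, 0 ≤ 4 * M₃ * P.δ j / Real.pi := fun j => by
      have := P.δ_pos hδ₀ hd j
      positivity
    have h1 : volume Bad ≤ ENNReal.ofReal VB := by
      refine hBadvol.trans (le_of_eq ?_)
      rw [hVB, ENNReal.ofReal_sum_of_nonneg fun j _ => hterm j]
      refine Finset.sum_congr rfl fun j _ => ?_
      rw [← ENNReal.ofReal_ofNat 2, ← ENNReal.ofReal_mul (by norm_num)]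
      congr 1
      ring
    exact ENNReal.toReal_le_of_le_ofReal (Finset.sum_nonneg fun j _ => hterm j) h1
  obtain ⟨hh_meas, hh01, hh_int⟩ := axisAvg_indicator_props hBadm
  set h : UnitAddTorus (Fin 2) → ℝ := axisAvg 0 (Bad.indicator fun _ => (1 : ℝ)) with hh
  set C₀ : ℝ := B n / Real.pi + 2 * Real.pi * EV with hC₀
  have hC₀0 : 0 ≤ C₀ := by positivity
  have hle : ∀ x, |axisAvg 0 (a n) x| ≤ C₀ + h x := fun x =>
    abs_axisAvg_iterate_le_lt P hγ h8 hδ₀ hd hN₀ hρ hM₁ hM hMδ a b h0 hb hab B hEV0 hEV hEH hζV hζH hB0 hB Bad hBadm hBad x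
  obtain ⟨hg_i, hΓ'⟩ := integral_const_add_sq_le hh_meas hh01 hC₀0
  rw [hh_int] at hΓ'
  have hΓ : ∫ x, (C₀ + h x) ^ 2 ≤ C₀ ^ 2 + (2 * C₀ + 1) * VB := hΓ'.trans (by gcongr)
  -- the slab minus the column
  set CK : ℝ := B n / (Real.pi * (1 - K / (P.γ ^ 2 - 3) ^ n)) + 2 * Real.pi * EV with hCK
  have hθ : 0 < 1 - (K : ℝ) / (P.γ ^ 2 - 3) ^ n := by
    rw [sub_pos, div_lt_one (pow_pos hg3 n)]; exact hK
  have hCK0 : 0 ≤ CK := by positivity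
  have hslab := slabEnergy_le_lt P hγ h8 hδ₀ hd hN₀ hρ hM₁ hM hMδ a b has h0 hb hab B hEV0 hEV hEH hζV hζH hB0 hB Bad hBadm hBad hK
  set R : Set (Fin 2 → ℤ) := {k | k 0 ≠ 0 ∧ |k 0| ≤ (K : ℤ)} with hR
  have hΛ : ∑' k : Fin 2 → ℤ, (if k ∈ R then (1 : ℝ) else 0) * ‖mFourierCoeff (fun x => (a n x : ℂ)) k‖ ^ 2 ≤
      2 * K * (CK ^ 2 + (2 * CK + 1) * VB) := by
    have heq : ∀ k : Fin 2 → ℤ, (if k ∈ R then (1 : ℝ) else 0) = (if (k 0 ≠ 0 ∧ |k 0| ≤ (K : ℤ)) then (1 : ℝ) else 0) :=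
      fun k => by simp only [hR, Set.mem_setOf_eq]
    simp_rw [heq]
    refine hslab.trans ?_
    have hK0 : (0 : ℝ) ≤ 2 * K := by positivity
    exact mul_le_mul_of_nonneg_left (by gcongr) hK0
  have hμR : ∀ k : Fin 2 → ℤ, k 0 ≠ 0 → k ∉ R → μ k = 0 := by
    intro k hk0 hkR
    refine hμ k (lt_of_not_ge fun hle' => hkR ?_)
    exact ⟨hk0, hle'⟩
  -- assemble
  have hres := sqrt_tsum_symbol_sq_datum_le_of_lineMean P hγ0.le hδ₀ hd a b has h0 hb hab n μ hμ1 R hμR hg_i hle hΓ hΛ (κ₁ := κ₁)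
  simpa only [hC₀, hCK, hVB] using hres

end Cascade

end Summit.AnomalousDissipation.AnomalousDissipation.Theorems.SawtoothPulseCascade.K1Start
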